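import Mathlib
import HarnessLib
import Literature.Analysis.FluidPDE.VectorCalculus
import Literature.Analysis.FluidPDE.Seregin2020SwirlEnergyInequality
import Summits.NavierStokesRegularity.NavierStokesRegularity.Theorems.UnthreadedDoorAntidynamoLambRadial
import Summits.NavierStokesRegularity.NavierStokesRegularity.Theorems.UnthreadedDoorAntidynamoSphereConstancy

/-!
# Route `UnthreadedDoor` / `ThreadingFlux`, crux `PoloidalLiouville` (stmt-NavierStokesRegularity-1222), antidynamo v2 skeleton
# (sha16 `4ebf5683127b`), rung `stub_singleDegreeRung`, EVEN degree — the bridge (E2) → (E3): THE SCALAR `Ψ` IS RADIAL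

Support file (seat leafhand-ns-unthreadeddoor-1 g1, cell decomp-ns), `--supports stmt-NavierStokesRegularity-1222 --as helper`; theorems only.

By `curl_lamb_eq_radial` (p800175) the vorticity equation of the single-degree ansatz reads, off the centre,
`−(c(r) P) • Λ − d(r) • (∇|∇P|² × y) − e(r) • Λ = 0` with radial `c = B′/r + 2lGa`, `d = Gk`, `e = F = G_t − G″ − (2l+2)G′/r`.  This file turns
that vector identity into the scalar statement used by the spherical-harmonic separation (E3):

* `sphereConst_of_cross_gradient_eq_zero_on` — sphere constancy LOCALISED to one sphere `‖y‖ = ρ > 0` (differentiability and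
  `∇Q × y = 0` only there; the g0 lemma `sphereConst_of_cross_gradient_eq_zero` asks for both globally);
* `cross_gradient_psi` — for `Ψ(y) = −½ c(‖y‖) P(y)² − d(‖y‖) |∇P(y)|² − e(‖y‖) P(y)`:
  `∇Ψ(y) × y = −(c P) • (∇P × y) − d • (∇|∇P|² × y) − e • (∇P × y)` (the radial derivatives drop out);
* `psi_sphereConst_of_lamb_identity` — hence the identity forces `Ψ` to be CONSTANT ON EVERY SPHERE about the centre.

HONEST LABEL: calculus input for the open even-degree rung; nothing here proves the rung, the wall, `PoloidalLiouville` (1222), or bears on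
Navier–Stokes regularity. [folklore]
-/

noncomputable section

-- the summit and its single sub-problem share the name (CONVENTIONS §1)
set_option linter.dupNamespace false

open scoped Topology InnerProductSpace RealInnerProductSpace ContDiff
open Filter Set Function Metric
open Literature.Analysis.FluidPDE

namespace Summit.NavierStokesRegularity.NavierStokesRegularity.Theorems.PoloidalLiouville.Antidynamo

/-! ### Sphere constancy, localised to one sphere -/

/-- Along a unit-sphere curve scaled to radius `ρ > 0`, a function differentiable on the sphere `‖y‖ = ρ` with radial gradient there
is constant. [folklore] -/
theorem comp_sphereCurve_const_on {Q : EuclideanSpace ℝ (Fin 3) → ℝ} {ρ : ℝ} (hρ : 0 < ρ)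
    (hQ : ∀ y, ‖y‖ = ρ → DifferentiableAt ℝ Q y) (hrad : ∀ y, ‖y‖ = ρ → cross (gradient Q y) y = 0)
    {γ : ℝ → EuclideanSpace ℝ (Fin 3)} (hγd : Differentiable ℝ γ) (hγ1 : ∀ τ, ‖γ τ‖ = 1) (τ₁ τ₂ : ℝ) :
    Q (ρ • γ τ₁) = Q (ρ • γ τ₂) := by
  have hnorm : ∀ τ, ‖ρ • γ τ‖ = ρ := fun τ => by
    rw [norm_smul, Real.norm_eq_abs, abs_of_pos hρ, hγ1 τ, mul_one]
  have hderiv : ∀ τ, HasDerivAt (fun t => Q (ρ • γ t)) 0 τ := by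
    intro τ
    have hin : HasDerivAt (fun t => ρ • γ t) (ρ • deriv γ τ) τ := (hγd τ).hasDerivAt.const_smul ρ
    have hφ' : HasFDerivAt Q ((InnerProductSpace.toDual ℝ (EuclideanSpace ℝ (Fin 3))) (gradient Q (ρ • γ τ))) (ρ • γ τ) :=
      (hQ _ (hnorm τ)).hasGradientAt.hasFDerivAt
    refine (hφ'.comp_hasDerivAt τ hin).congr_deriv ?_
    rw [InnerProductSpace.toDual_apply_apply]
    have hz : ρ • γ τ ≠ 0 := by rw [← norm_ne_zero_iff, hnorm τ]; exact hρ.ne'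
    rw [eq_smul_of_cross_eq_zero hz (hrad _ (hnorm τ))]
    simp only [real_inner_smul_left, real_inner_smul_right, inner_self_deriv_eq_zero_of_norm_eq_one hγd hγ1 τ,
      mul_zero]
  have hdiff : Differentiable ℝ fun t => Q (ρ • γ t) := fun τ => (hderiv τ).differentiableAt
  exact is_const_of_deriv_eq_zero hdiff (fun τ => (hderiv τ).deriv) τ₁ τ₂

/-- **SPHERE CONSTANCY ON ONE SPHERE**: if `Q` is differentiable at the points of the sphere `‖y‖ = ρ > 0` and `∇Q × y = 0` there, then
`Q y₁ = Q y₂` for all `y₁, y₂` on that sphere (join two non-antipodal directions by a smooth sphere curve, antipodal ones through a third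
point; the argument of `sphereConst_of_cross_gradient_eq_zero`). [folklore] -/
theorem sphereConst_of_cross_gradient_eq_zero_on {Q : EuclideanSpace ℝ (Fin 3) → ℝ} {ρ : ℝ} (hρ : 0 < ρ)
    (hQ : ∀ y, ‖y‖ = ρ → DifferentiableAt ℝ Q y) (hrad : ∀ y, ‖y‖ = ρ → cross (gradient Q y) y = 0)
    {y₁ y₂ : EuclideanSpace ℝ (Fin 3)} (h₁ : ‖y₁‖ = ρ) (h₂ : ‖y₂‖ = ρ) : Q y₁ = Q y₂ := by
  have hy₁0 : y₁ ≠ 0 := by rw [← norm_ne_zero_iff, h₁]; exact hρ.ne'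
  set θ₁ : EuclideanSpace ℝ (Fin 3) := ρ⁻¹ • y₁ with hθ₁
  set θ₂ : EuclideanSpace ℝ (Fin 3) := ρ⁻¹ • y₂ with hθ₂
  have hθ₁1 : ‖θ₁‖ = 1 := by rw [hθ₁, norm_smul, Real.norm_eq_abs, abs_of_pos (inv_pos.2 hρ), h₁, inv_mul_cancel₀ hρ.ne']
  have hθ₂1 : ‖θ₂‖ = 1 := by rw [hθ₂, norm_smul, Real.norm_eq_abs, abs_of_pos (inv_pos.2 hρ), h₂, inv_mul_cancel₀ hρ.ne']
  have hy₁θ : y₁ = ρ • θ₁ := by rw [hθ₁, smul_smul, mul_inv_cancel₀ hρ.ne', one_smul]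
  have hy₂θ : y₂ = ρ • θ₂ := by rw [hθ₂, smul_smul, mul_inv_cancel₀ hρ.ne', one_smul]
  have join : ∀ a b : EuclideanSpace ℝ (Fin 3), ‖a‖ = 1 → ‖b‖ = 1 → b ≠ -a → Q (ρ • a) = Q (ρ • b) := by
    intro a b ha hb hab
    obtain ⟨γ, hγs, hγ1, hγ0, hγone, -⟩ := exists_smooth_sphereCurve ha hb hab
    have := comp_sphereCurve_const_on hρ hQ hrad (hγs.differentiable (by simp)) hγ1 0 1
    rwa [hγ0, hγone] at this
  rw [hy₁θ, hy₂θ]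
  by_cases hanti : θ₂ = -θ₁
  · set e0 : EuclideanSpace ℝ (Fin 3) := EuclideanSpace.single 0 1 with he0
    set e1 : EuclideanSpace ℝ (Fin 3) := EuclideanSpace.single 1 1 with he1
    have he0n : ‖e0‖ = 1 := by rw [he0, EuclideanSpace.norm_eq]; simp
    have he1n : ‖e1‖ = 1 := by rw [he1, EuclideanSpace.norm_eq]; simp
    have he01 : e0 ≠ e1 := by
      intro h; have := congrArg (fun v : EuclideanSpace ℝ (Fin 3) => v 0) h; simp [he0, he1] at this
    have he01' : e0 ≠ -e1 := by
      intro h; have := congrArg (fun v : EuclideanSpace ℝ (Fin 3) => v 0) h; simp [he0, he1] at this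
    obtain ⟨e, hen, he₁, he₂⟩ : ∃ e : EuclideanSpace ℝ (Fin 3), ‖e‖ = 1 ∧ e ≠ -θ₁ ∧ e ≠ θ₁ := by
      by_cases h1 : e0 = θ₁
      · refine ⟨e1, he1n, ?_, ?_⟩
        · intro h; apply he01'; rw [h1, h, neg_neg]
        · intro h; exact he01 (h1.trans h.symm)
      by_cases h2 : e0 = -θ₁
      · refine ⟨e1, he1n, ?_, ?_⟩
        · intro h; exact he01 (h2.trans h.symm)
        · intro h; apply he01'; rw [h]; exact h2
      · exact ⟨e0, he0n, h2, h1⟩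
    have hA := join θ₁ e hθ₁1 hen he₁
    have hB := join e θ₂ hen hθ₂1 (by
      rw [hanti]
      exact fun h => he₂ (neg_injective h).symm)
    exact hA.trans hB
  · exact join θ₁ θ₂ hθ₁1 hθ₂1 hanti

/-! ### The scalar `Ψ` -/

/-- **`∇Ψ × y` for `Ψ = −½ c(r) P² − d(r) |∇P|² − e(r) P`**: the radial derivatives of the coefficients drop out,
`∇Ψ(y) × y = −(c P) • (∇P × y) − d • (∇|∇P|² × y) − e • (∇P × y)` (`y ≠ 0`, `P ∈ C²`, `c, d, e` differentiable at `‖y‖`). [folklore] -/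
theorem cross_gradient_psi {c d e : ℝ → ℝ} {P : EuclideanSpace ℝ (Fin 3) → ℝ} (hP : ContDiff ℝ 2 P)
    {y : EuclideanSpace ℝ (Fin 3)} (hy : y ≠ 0) (hc : DifferentiableAt ℝ c ‖y‖) (hd : DifferentiableAt ℝ d ‖y‖)
    (he : DifferentiableAt ℝ e ‖y‖) :
    cross (gradient (fun z : EuclideanSpace ℝ (Fin 3) =>
        -(1 / 2) * c ‖z‖ * (P z * P z) - d ‖z‖ * ⟪gradient P z, gradient P z⟫ - e ‖z‖ * P z) y) y =
      -((c ‖y‖ * P y) • cross (gradient P y) y) - d ‖y‖ • cross (gradient (fun z => ⟪gradient P z, gradient P z⟫) y) y -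
        e ‖y‖ • cross (gradient P y) y := by
  have hn : DifferentiableAt ℝ (fun z : EuclideanSpace ℝ (Fin 3) => ‖z‖) y :=
    (contDiffAt_norm ℝ hy (n := 1)).differentiableAt (by simp)
  have hPd : DifferentiableAt ℝ P y := (hP.differentiable (by norm_num)) y
  have hgP : DifferentiableAt ℝ (gradient P) y := (differentiable_gradient_of_contDiff_two hP) y
  have hPP : DifferentiableAt ℝ (fun z : EuclideanSpace ℝ (Fin 3) => P z * P z) y := hPd.mul hPd
  have hgg : DifferentiableAt ℝ (fun z : EuclideanSpace ℝ (Fin 3) => ⟪gradient P z, gradient P z⟫) y := hgP.inner ℝ hgP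
  have hc' : DifferentiableAt ℝ (fun r => -(1 / 2) * c r) ‖y‖ := (differentiableAt_const _).mul hc
  -- regroup `Ψ = (−½ c)(r) · P² + (−d)(r) · |∇P|² + (−e)(r) · P`
  have hfun : (fun z : EuclideanSpace ℝ (Fin 3) =>
      -(1 / 2) * c ‖z‖ * (P z * P z) - d ‖z‖ * ⟪gradient P z, gradient P z⟫ - e ‖z‖ * P z) =
      fun z => ((-(1 / 2) * c ‖z‖) * (P z * P z) + (-d ‖z‖) * ⟪gradient P z, gradient P z⟫) + (-e ‖z‖) * P z := by
    funext z; ring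
  rw [hfun]
  have h1 : DifferentiableAt ℝ (fun z : EuclideanSpace ℝ (Fin 3) => (-(1 / 2) * c ‖z‖) * (P z * P z)) y := (hc'.comp y hn).mul hPP
  have h2 : DifferentiableAt ℝ (fun z : EuclideanSpace ℝ (Fin 3) => (-d ‖z‖) * ⟪gradient P z, gradient P z⟫) y :=
    (hd.neg.comp y hn).mul hgg
  have h3 : DifferentiableAt ℝ (fun z : EuclideanSpace ℝ (Fin 3) => (-e ‖z‖) * P z) y := (he.neg.comp y hn).mul hPd
  have h12 : DifferentiableAt ℝ (fun z : EuclideanSpace ℝ (Fin 3) =>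
      (-(1 / 2) * c ‖z‖) * (P z * P z) + (-d ‖z‖) * ⟪gradient P z, gradient P z⟫) y := h1.add h2
  rw [gradient_fun_add' h12 h3, gradient_fun_add' h1 h2, ← crossCLM_apply, map_add, map_add]
  simp only [_root_.add_apply, crossCLM_apply]
  rw [cross_gradient_radialMul (ĝ := fun r => -(1 / 2) * c r) hy hc' hPP,
    cross_gradient_radialMul (ĝ := fun r => -d r) hy hd.neg hgg,
    cross_gradient_radialMul (ĝ := fun r => -e r) hy he.neg hPd,
    Literature.Analysis.FluidPDE.Seregin2020.gradient_mul_apply' hPd hPd, ← two_smul ℝ, smul_smul, ← crossCLM_apply,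
    map_smul, _root_.smul_apply, crossCLM_apply, smul_smul, neg_smul, neg_smul, sub_eq_add_neg, sub_eq_add_neg]
  congr 1
  congr 1
  rw [← neg_smul]
  congr 1
  ring

/-- ★ **THE SCALAR `Ψ` IS RADIAL.**  If the single-degree vorticity identity
`−(c(‖y‖) P(y)) • (∇P(y) × y) − d(‖y‖) • (∇|∇P|²(y) × y) − e(‖y‖) • (∇P(y) × y) = 0` holds for all `y ≠ 0` (the form delivered by
`curl_lamb_eq_radial` for the vorticity equation of the ansatz), with `P ∈ C²` and `c, d, e` differentiable on `(0, ∞)`, then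
`Ψ(y) = −½ c(‖y‖) P(y)² − d(‖y‖)|∇P(y)|² − e(‖y‖) P(y)` is constant on every sphere about the centre. [folklore] -/
theorem psi_sphereConst_of_lamb_identity {c d e : ℝ → ℝ} {P : EuclideanSpace ℝ (Fin 3) → ℝ} (hP : ContDiff ℝ 2 P)
    (hc : ∀ r, 0 < r → DifferentiableAt ℝ c r) (hd : ∀ r, 0 < r → DifferentiableAt ℝ d r)
    (he : ∀ r, 0 < r → DifferentiableAt ℝ e r)
    (hid : ∀ y : EuclideanSpace ℝ (Fin 3), y ≠ 0 →
      -((c ‖y‖ * P y) • cross (gradient P y) y) - d ‖y‖ • cross (gradient (fun z => ⟪gradient P z, gradient P z⟫) y) y -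
        e ‖y‖ • cross (gradient P y) y = 0)
    {y₁ y₂ : EuclideanSpace ℝ (Fin 3)} (hy₁ : y₁ ≠ 0) (hn : ‖y₁‖ = ‖y₂‖) :
    (-(1 / 2) * c ‖y₁‖ * (P y₁ * P y₁) - d ‖y₁‖ * ⟪gradient P y₁, gradient P y₁⟫ - e ‖y₁‖ * P y₁) =
      (-(1 / 2) * c ‖y₂‖ * (P y₂ * P y₂) - d ‖y₂‖ * ⟪gradient P y₂, gradient P y₂⟫ - e ‖y₂‖ * P y₂) := by
  set ρ : ℝ := ‖y₁‖ with hρ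
  have hρ0 : 0 < ρ := norm_pos_iff.2 hy₁
  have hPd : Differentiable ℝ P := hP.differentiable (by norm_num)
  have hgP : Differentiable ℝ (gradient P) := differentiable_gradient_of_contDiff_two hP
  refine sphereConst_of_cross_gradient_eq_zero_on (Q := fun z : EuclideanSpace ℝ (Fin 3) =>
      -(1 / 2) * c ‖z‖ * (P z * P z) - d ‖z‖ * ⟪gradient P z, gradient P z⟫ - e ‖z‖ * P z) hρ0 ?_ ?_ rfl hn.symm
  · intro y hy
    have hy0 : y ≠ 0 := by rw [← norm_ne_zero_iff, hy]; exact hρ0.ne'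
    have hny : DifferentiableAt ℝ (fun z : EuclideanSpace ℝ (Fin 3) => ‖z‖) y :=
      (contDiffAt_norm ℝ hy0 (n := 1)).differentiableAt (by simp)
    have hcy : DifferentiableAt ℝ (fun z : EuclideanSpace ℝ (Fin 3) => c ‖z‖) y := (hc _ (by rw [hy]; exact hρ0)).comp y hny
    have hdy : DifferentiableAt ℝ (fun z : EuclideanSpace ℝ (Fin 3) => d ‖z‖) y := (hd _ (by rw [hy]; exact hρ0)).comp y hny
    have hey : DifferentiableAt ℝ (fun z : EuclideanSpace ℝ (Fin 3) => e ‖z‖) y := (he _ (by rw [hy]; exact hρ0)).comp y hny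
    exact ((((differentiableAt_const _).mul hcy).mul ((hPd y).mul (hPd y))).sub
      (hdy.mul ((hgP y).inner ℝ (hgP y)))).sub (hey.mul (hPd y))
  · intro y hy
    have hy0 : y ≠ 0 := by rw [← norm_ne_zero_iff, hy]; exact hρ0.ne'
    have hr : 0 < ‖y‖ := by rw [hy]; exact hρ0
    rw [cross_gradient_psi hP hy0 (hc _ hr) (hd _ hr) (he _ hr)]
    exact hid y hy0

end Summit.NavierStokesRegularity.NavierStokesRegularity.Theorems.PoloidalLiouville.Antidynamo

end
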